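import Mathlib
import HarnessLib.Audit
import Summits.PneNP.PneNP.Theorems.PstarCrossProductRow
import Summits.PneNP.PneNP.Theorems.PstarCrossProductAlgebra

/-!
# The blind free CROSS gate, regime U2 (node N4): product rows are NON-DEGENERATE and live on the fundamental set of `e₀`; carrier or corner (O2 / E1; prover-1 g23)

FRONTIER range-avoidance ladder, rung F-N3 (`stmt-PneNP-19007`), cell `pnp-ideate`; restricted-model proof complexity — nothing here bears on `P` versus `NP`.

Node N4 (`PstarCrossNodes.CrossU2`), continuing `PstarCrossCaseU2` / `PstarCrossCaseU2Clean` / `PstarCrossProductRow`.  With `u₀ := u_{e₀} = γ₀ + Q_{D e₀}`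
(rank `≥ 4`) and a row `q_{mv} + κ = μ₁ μ₂` or `u₀ + (q_{mv} + κ) = μ₁ μ₂` of the constraint `(C, G, T)` behind `q_{mv}`:

* `clean_or_nondeg` — the rows of `PstarCrossCaseU2.classification_u` are CLEAN (`0`, `u₀`) or a NON-DEGENERATE product (both linear parts non-zero
  and distinct): a degenerate product is affine and vanishes on `Z(u₀)`, hence is `0` (`PstarCrossProductAlgebra.mul_eq_zero_of_degenerate`);
* `factors_fixed_off_D` — the linear parts of a non-degenerate row are supported on the AND variables of `D e₀` (`PstarCrossProductAlgebra.shift_of_vanish`: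
  `u₀` is invariant under translation by any other coordinate); so `untouched_of_not_mem_D` — a private tree edge OUTSIDE `D e₀` is not read by the row;
* `carrier_or_corner` — pure coordinates: if the linear parts do not both vanish at the AND variables `v, v'` of a private tree edge `π`, then either
  there are `w ∈ {v, v'}` and `b ∉ {v, v'}` with `λ₁(b)λ₂(w) + λ₁(w)λ₂(b) = 1` (a carrier pair), or both linear parts are supported on `{v, v'}` (the
  corner).  The carrier and the corner are evaluated in `PstarCrossCaseU2Carrier`.
-/

set_option linter.dupNamespace false -- `Summit.PneNP.PneNP.…`: summit = sub-problem name (D-0017 single-conjunct layout)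

open Finset Module Literature.Computability.Complexity
open Summit.PneNP.PneNP.Theorems.PstarTyped (Typed)
open Summit.PneNP.PneNP.Theorems.PstarSALevel (varSet BoundaryExpanding SimpleOverlap)
open Summit.PneNP.PneNP.Theorems.PstarCentreFree (vars_mem_varSet)
open Summit.PneNP.PneNP.Theorems.PstarCubeIdeals (IsAffineFn IsQuadFn)
open Summit.PneNP.PneNP.Theorems.PstarProductRank (qform polar)
open Summit.PneNP.PneNP.Theorems.PstarPathRank (AndAdj polar_basis and_ne)
open Summit.PneNP.PneNP.Theorems.PstarReadSumset (V2)
open Summit.PneNP.PneNP.Theorems.PstarRankRigidityTwo (affine_mul_polar symForm_apply linPart_apply)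
open Summit.PneNP.PneNP.Theorems.PstarChordSystem (ChordSystem)
open Summit.PneNP.PneNP.Theorems.PstarChordBridgeTools
open Summit.PneNP.PneNP.Theorems.PstarChordBridge
open Summit.PneNP.PneNP.Theorems.PstarChordBridgeForcing (freeMon gam sys_u_eq qform_add' rank_four_of_wf)
open Summit.PneNP.PneNP.Theorems.PstarChordBridgeBasis (qDir polarDir)
open Summit.PneNP.PneNP.Theorems.PstarChordBridgeCorner (qDir_add)
open Summit.PneNP.PneNP.Theorems.PstarCrossData (CrossData)
open Summit.PneNP.PneNP.Theorems.PstarCrossSystem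
open Summit.PneNP.PneNP.Theorems.PstarCrossCorner (PrivEdge)
open Summit.PneNP.PneNP.Theorems.PstarCrossCasePEmptyToggle (andAdj_priv_iff)
open Summit.PneNP.PneNP.Theorems.PstarCrossCaseU2 (u_add classification_u)
open Summit.PneNP.PneNP.Theorems.PstarCrossProductRow (untouched_of_product_row)
open Summit.PneNP.PneNP.Theorems.PstarCrossProductAlgebra

namespace Summit.PneNP.PneNP.Theorems.PstarCrossCaseU2Touch

variable {n m : ℕ}

/-! ## Coordinates: carrier or corner -/

/-- An affine function whose linear part vanishes at every coordinate is constant. -/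
theorem affine_const_of_coords {μ : (Fin n → ZMod 2) → ZMod 2} (hμ : IsAffineFn μ) (h : ∀ i, μ (Pi.single i 1) = μ 0) (z : Fin n → ZMod 2) :
    μ z = μ 0 :=
  affine_eq_of_agree hμ (W := ∅) (fun i _ => h i) (x := z) (x' := 0) fun i hi => absurd hi (Finset.notMem_empty i)

/-- Two affine functions whose linear parts agree at every coordinate have equal linear parts. -/
theorem linParts_eq_of_coords {μ₁ μ₂ : (Fin n → ZMod 2) → ZMod 2} (h₁ : IsAffineFn μ₁) (h₂ : IsAffineFn μ₂)
    (h : ∀ i, μ₁ (Pi.single i 1) + μ₁ 0 = μ₂ (Pi.single i 1) + μ₂ 0) (z : Fin n → ZMod 2) : μ₁ z + μ₁ 0 = μ₂ z + μ₂ 0 := by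
  have hα : IsAffineFn fun x => μ₁ x + μ₂ x := fun x w => by
    show μ₁ (x + w) + μ₂ (x + w) = μ₁ x + μ₂ x + (μ₁ w + μ₂ w) + (μ₁ 0 + μ₂ 0)
    rw [h₁ x w, h₂ x w]
    generalize μ₁ x = a; generalize μ₁ w = b; generalize μ₁ 0 = c
    generalize μ₂ x = a'; generalize μ₂ w = b'; generalize μ₂ 0 = c'
    revert a b c a' b' c'; decide
  have hc := affine_const_of_coords hα (fun i => by
    have e : ∀ a b c d : ZMod 2, a + b = c + d → a + c = b + d := by decide
    exact e _ _ _ _ (h i)) z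
  have e : ∀ a b c d : ZMod 2, a + c = b + d → a + b = c + d := by decide
  exact e _ _ _ _ hc

/-- **Carrier or corner, core case** (the linear parts do not both vanish at `v`).  See `carrier_or_corner`. -/
theorem carrier_or_corner_core {μ₁ μ₂ : (Fin n → ZMod 2) → ZMod 2} (h₁ : IsAffineFn μ₁) (h₂ : IsAffineFn μ₂)
    (hn₁ : ∃ z, μ₁ z ≠ μ₁ 0) (hn₂ : ∃ z, μ₂ z ≠ μ₂ 0) (hn : ∃ z, μ₁ z + μ₁ 0 ≠ μ₂ z + μ₂ 0) {v v' : Fin n}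
    (hv : ¬ (μ₁ (Pi.single v 1) + μ₁ 0 = 0 ∧ μ₂ (Pi.single v 1) + μ₂ 0 = 0)) :
    (∃ w, (w = v ∨ w = v') ∧ ∃ b, b ≠ v ∧ b ≠ v' ∧
      (μ₁ (Pi.single b 1) + μ₁ 0) * (μ₂ (Pi.single w 1) + μ₂ 0) + (μ₁ (Pi.single w 1) + μ₁ 0) * (μ₂ (Pi.single b 1) + μ₂ 0) = 1) ∨
    (∀ b, b ≠ v → b ≠ v' → μ₁ (Pi.single b 1) + μ₁ 0 = 0 ∧ μ₂ (Pi.single b 1) + μ₂ 0 = 0) := by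
  by_contra hcon
  push Not at hcon
  obtain ⟨hnc, b₀, hb₀v, hb₀v', hb₀⟩ := hcon
  -- abbreviations for the linear parts at coordinates
  set L₁ : Fin n → ZMod 2 := fun c => μ₁ (Pi.single c 1) + μ₁ 0 with hL₁
  set L₂ : Fin n → ZMod 2 := fun c => μ₂ (Pi.single c 1) + μ₂ 0 with hL₂
  have hncv : ∀ b, b ≠ v → b ≠ v' → L₁ b * L₂ v + L₁ v * L₂ b ≠ 1 := fun b hb hb' => hnc v (Or.inl rfl) b hb hb'
  have hncv' : ∀ b, b ≠ v → b ≠ v' → L₁ b * L₂ v' + L₁ v' * L₂ b ≠ 1 := fun b hb hb' => hnc v' (Or.inr rfl) b hb hb'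
  have hv' : ¬ (L₁ v = 0 ∧ L₂ v = 0) := hv
  have hb₀' : L₁ b₀ ≠ 0 ∨ L₂ b₀ ≠ 0 := by
    by_contra h; push Not at h; exact hb₀ h.1 h.2
  have e01 : ∀ t : ZMod 2, t = 0 ∨ t = 1 := by decide
  -- the constant and equal-linear-part conclusions contradict non-degeneracy
  have hcon₁ : ¬ ∀ c, L₁ c = 0 := fun h => by
    obtain ⟨z, hz⟩ := hn₁
    have e : ∀ a b : ZMod 2, a + b = 0 → a = b := by decide
    exact hz (affine_const_of_coords h₁ (fun i => e _ _ (h i)) z)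
  have hcon₂ : ¬ ∀ c, L₂ c = 0 := fun h => by
    obtain ⟨z, hz⟩ := hn₂
    have e : ∀ a b : ZMod 2, a + b = 0 → a = b := by decide
    exact hz (affine_const_of_coords h₂ (fun i => e _ _ (h i)) z)
  have hcon₁₂ : ¬ ∀ c, L₁ c = L₂ c := fun h => by
    obtain ⟨z, hz⟩ := hn
    exact hz (linParts_eq_of_coords h₁ h₂ h z)
  -- every coordinate is `v`, `v'`, or off `π`
  have tri : ∀ c, c = v ∨ c = v' ∨ (c ≠ v ∧ c ≠ v') := fun c => by
    by_cases h1 : c = v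
    · exact Or.inl h1
    · by_cases h2 : c = v'
      · exact Or.inr (Or.inl h2)
      · exact Or.inr (Or.inr ⟨h1, h2⟩)
  rcases e01 (L₁ v) with a0 | a1 <;> rcases e01 (L₂ v) with b0 | b1
  · exact hv' ⟨a0, b0⟩
  · -- `(0,1)` at `v`: `L₁` vanishes everywhere
    refine hcon₁ fun c => ?_
    have hoff : ∀ b, b ≠ v → b ≠ v' → L₁ b = 0 := fun b hb hb' => by
      have h := hncv b hb hb'
      rw [a0, b1] at h
      revert h; generalize L₁ b = s; generalize L₂ b = t; revert s t; decide
    have hv'0 : L₁ v' = 0 := by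
      have h := hncv' b₀ hb₀v hb₀v'
      have h0 := hoff b₀ hb₀v hb₀v'
      rw [h0] at h hb₀'
      revert h hb₀'; generalize L₁ v' = s; generalize L₂ v' = s'; generalize L₂ b₀ = t; revert s s' t; decide
    rcases tri c with rfl | rfl | ⟨hc, hc'⟩
    · exact a0
    · exact hv'0
    · exact hoff c hc hc'
  · -- `(1,0)` at `v`: `L₂` vanishes everywhere
    refine hcon₂ fun c => ?_
    have hoff : ∀ b, b ≠ v → b ≠ v' → L₂ b = 0 := fun b hb hb' => by
      have h := hncv b hb hb'
      rw [a1, b0] at h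
      revert h; generalize L₁ b = s; generalize L₂ b = t; revert s t; decide
    have hv'0 : L₂ v' = 0 := by
      have h := hncv' b₀ hb₀v hb₀v'
      have h0 := hoff b₀ hb₀v hb₀v'
      rw [h0] at h hb₀'
      revert h hb₀'; generalize L₁ v' = s; generalize L₂ v' = s'; generalize L₁ b₀ = t; revert s s' t; decide
    rcases tri c with rfl | rfl | ⟨hc, hc'⟩
    · exact b0
    · exact hv'0
    · exact hoff c hc hc'
  · -- `(1,1)` at `v`: the linear parts agree everywhere
    refine hcon₁₂ fun c => ?_
    have hoff : ∀ b, b ≠ v → b ≠ v' → L₁ b = L₂ b := fun b hb hb' => by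
      have h := hncv b hb hb'
      rw [a1, b1] at h
      revert h; generalize L₁ b = s; generalize L₂ b = t; revert s t; decide
    have hv'e : L₁ v' = L₂ v' := by
      have h := hncv' b₀ hb₀v hb₀v'
      have h0 := hoff b₀ hb₀v hb₀v'
      rw [h0] at h hb₀'
      revert h hb₀'; generalize L₁ v' = s; generalize L₂ v' = s'; generalize L₂ b₀ = t; revert s s' t; decide
    rcases tri c with rfl | rfl | ⟨hc, hc'⟩
    · rw [a1, b1]
    · exact hv'e
    · exact hoff c hc hc'

/-- **Carrier or corner.**  `μ₁, μ₂` a non-degenerate pair of affine functions on `Fin n → 𝔽₂` whose linear parts `λᵢ(c) = μᵢ(e_c) + μᵢ(0)` do not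
both vanish at some `w₀ ∈ {v, v'}`.  Then EITHER there are `w ∈ {v, v'}` and `b ∉ {v, v'}` with `λ₁(b)λ₂(w) + λ₁(w)λ₂(b) = 1` (a carrier pair), OR
both linear parts vanish at every coordinate off `{v, v'}` (the corner). -/
theorem carrier_or_corner {μ₁ μ₂ : (Fin n → ZMod 2) → ZMod 2} (h₁ : IsAffineFn μ₁) (h₂ : IsAffineFn μ₂)
    (hn₁ : ∃ z, μ₁ z ≠ μ₁ 0) (hn₂ : ∃ z, μ₂ z ≠ μ₂ 0) (hn : ∃ z, μ₁ z + μ₁ 0 ≠ μ₂ z + μ₂ 0) {v v' w₀ : Fin n} (hw₀ : w₀ = v ∨ w₀ = v')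
    (hv : ¬ (μ₁ (Pi.single w₀ 1) + μ₁ 0 = 0 ∧ μ₂ (Pi.single w₀ 1) + μ₂ 0 = 0)) :
    (∃ w, (w = v ∨ w = v') ∧ ∃ b, b ≠ v ∧ b ≠ v' ∧
      (μ₁ (Pi.single b 1) + μ₁ 0) * (μ₂ (Pi.single w 1) + μ₂ 0) + (μ₁ (Pi.single w 1) + μ₁ 0) * (μ₂ (Pi.single b 1) + μ₂ 0) = 1) ∨
    (∀ b, b ≠ v → b ≠ v' → μ₁ (Pi.single b 1) + μ₁ 0 = 0 ∧ μ₂ (Pi.single b 1) + μ₂ 0 = 0) := by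
  rcases hw₀ with rfl | rfl
  · exact carrier_or_corner_core h₁ h₂ hn₁ hn₂ hn hv
  · rcases carrier_or_corner_core h₁ h₂ hn₁ hn₂ hn (v' := v) hv with ⟨w, hw, b, hb, hb', h⟩ | h
    · exact Or.inl ⟨w, hw.symm, b, hb', hb, h⟩
    · exact Or.inr fun b hb hb' => h b hb' hb

/-! ## In the bridge: rows against `u₀ = γ₀ + Q_{D e₀}` -/

section

variable (I : LocalMap 4 n m) {r : ℕ} {B : BridgeData n m} {e_p e_q g₀ : Fin m}

/-- The radius bound of cross data covers the core. -/
theorem card_J₀_le (hD : CrossData I r B e_p e_q g₀) : B.J₀.card ≤ r :=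
  le_trans (card_le_card (subset_union_left.trans subset_union_left)) hD.rad

/-- **Rows are clean or NON-DEGENERATE products.**  `g` quadratic vanishing on `Z(u₀)` is `0`, `u₀`, or (up to adding `u₀`) a product `μ₁ μ₂` of affine
functions with both linear parts non-zero and distinct. -/
theorem clean_or_nondeg (hI : I.IsPure xorAndPred) (hS : SimpleOverlap I) (hB : BoundaryExpanding r I) (hD : CrossData I r B e_p e_q g₀) {e₀ : Fin m}
    (he₀ : e₀ ∈ B.N) {g : (Fin n → ZMod 2) → ZMod 2} (hg : IsQuadFn g) (hZ : ∀ x, (sys I B).u e₀ x = 0 → g x = 0) :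
    ((∀ x, g x = 0) ∨ (∀ x, g x = (sys I B).u e₀ x)) ∨
    (∃ μ₁ μ₂ : (Fin n → ZMod 2) → ZMod 2, IsAffineFn μ₁ ∧ IsAffineFn μ₂ ∧
      (∃ z, μ₁ z ≠ μ₁ 0) ∧ (∃ z, μ₂ z ≠ μ₂ 0) ∧ (∃ z, μ₁ z + μ₁ 0 ≠ μ₂ z + μ₂ 0) ∧
      ((∀ x, g x = μ₁ x * μ₂ x) ∨ (∀ x, (sys I B).u e₀ x + g x = μ₁ x * μ₂ x))) := by
  rcases classification_u I hI hS hB hD he₀ hg hZ with h | ⟨μ₁, μ₂, hμ₁, hμ₂, hrow⟩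
  · exact Or.inl h
  · have hu := u_add I B e₀
    have hrank := rank_four_of_wf I hI hS hB hD.wf (card_J₀_le I hD) he₀
    -- the product vanishes on `Z(u₀)` in either row
    have hPZ : ∀ x, (sys I B).u e₀ x = 0 → μ₁ x * μ₂ x = 0 := fun x hx => by
      rcases hrow with h | h
      · rw [← h x, hZ x hx]
      · rw [← h x, hZ x hx, hx, add_zero]
    by_cases hdeg : (∀ z, μ₁ z = μ₁ 0) ∨ (∀ z, μ₂ z = μ₂ 0) ∨ (∀ z, μ₁ z + μ₁ 0 = μ₂ z + μ₂ 0)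
    · -- degenerate: the product is `0`, the row is clean
      have h0 := mul_eq_zero_of_degenerate hu hrank hμ₁ hμ₂ hdeg hPZ
      left
      rcases hrow with h | h
      · exact Or.inl fun x => by rw [h x, h0 x]
      · refine Or.inr fun x => ?_
        have e : ∀ u a : ZMod 2, u + a = 0 → a = u := by decide
        exact e _ _ (by rw [h x, h0 x])
    · push Not at hdeg
      obtain ⟨hn₁, hn₂, hn⟩ := hdeg
      exact Or.inr ⟨μ₁, μ₂, hμ₁, hμ₂, hn₁, hn₂, hn, hrow⟩

/-- `u₀` is invariant under translation by a coordinate that is no AND variable of `D e₀`. -/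
theorem u_add_single_of_unread (B : BridgeData n m) (e₀ : Fin m) {z : Fin n} (hz : ∀ j ∈ B.D e₀, I.vars j 2 ≠ z ∧ I.vars j 3 ≠ z)
    (x : Fin n → ZMod 2) : (sys I B).u e₀ (x + Pi.single z 1) = (sys I B).u e₀ x := by
  rw [sys_u_eq, sys_u_eq]
  unfold qform
  congr 1
  refine sum_congr rfl fun j hj => ?_
  obtain ⟨h2, h3⟩ := hz j hj
  rw [Pi.add_apply, Pi.add_apply, Pi.single_eq_of_ne h2, Pi.single_eq_of_ne h3, add_zero, add_zero]

/-- **The linear parts of a non-degenerate row live on the AND variables of `D e₀`**: at any other coordinate `z`, `μᵢ(e_z) = μᵢ(0)`. -/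
theorem factors_fixed_off_D (hI : I.IsPure xorAndPred) (hS : SimpleOverlap I) (hB : BoundaryExpanding r I) (hD : CrossData I r B e_p e_q g₀)
    {e₀ : Fin m} (he₀ : e₀ ∈ B.N) {μ₁ μ₂ : (Fin n → ZMod 2) → ZMod 2} (h₁ : IsAffineFn μ₁) (h₂ : IsAffineFn μ₂)
    (hn₁ : ∃ z, μ₁ z ≠ μ₁ 0) (hn₂ : ∃ z, μ₂ z ≠ μ₂ 0) (hn : ∃ z, μ₁ z + μ₁ 0 ≠ μ₂ z + μ₂ 0)
    (hZ : ∀ x, (sys I B).u e₀ x = 0 → μ₁ x * μ₂ x = 0) {z : Fin n} (hz : ∀ j ∈ B.D e₀, I.vars j 2 ≠ z ∧ I.vars j 3 ≠ z) :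
    μ₁ (Pi.single z 1) = μ₁ 0 ∧ μ₂ (Pi.single z 1) = μ₂ 0 :=
  shift_of_vanish (u_add I B e₀) (rank_four_of_wf I hI hS hB hD.wf (card_J₀_le I hD) he₀) h₁ h₂ hn₁ hn₂ hn hZ
    (u_add_single_of_unread I B e₀ hz)

/-- An AND variable of a private tree edge outside `D e₀` is no AND variable of `D e₀`. -/
theorem unread_of_not_mem_D (hD : CrossData I r B e_p e_q g₀) {e₀ : Fin m} (he₀ : e₀ ∈ B.N) {π : Fin m} (hπ : PrivEdge I B π)
    (hπD : π ∉ B.D e₀) {s : Fin 4} (hs : s = 2 ∨ s = 3) : ∀ j ∈ B.D e₀, I.vars j 2 ≠ I.vars π s ∧ I.vars j 3 ≠ I.vars π s := by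
  intro j hj
  have hjJ : j ∈ B.J₀ := (mem_sdiff.1 (hD.wf.hD e₀ he₀ hj)).1
  have hjπ : j ≠ π := fun h => hπD (h ▸ hj)
  have h := hπ.2 j hjJ hjπ
  rcases hs with rfl | rfl
  · exact ⟨fun e => h.1 (e ▸ vars_mem_varSet I j 2), fun e => h.1 (e ▸ vars_mem_varSet I j 3)⟩
  · exact ⟨fun e => h.2 (e ▸ vars_mem_varSet I j 2), fun e => h.2 (e ▸ vars_mem_varSet I j 3)⟩

/-- An AND variable of a private tree edge `π` differs from every variable of another output of the core. -/
theorem ne_of_privEdge {π : Fin m} (hπ : PrivEdge I B π) {s : Fin 4} (hs : s = 2 ∨ s = 3) {j : Fin m} (hj : j ∈ B.J₀) (hjπ : j ≠ π)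
    (s' : Fin 4) : I.vars j s' ≠ I.vars π s := by
  have h := hπ.2 j hj hjπ
  rcases hs with rfl | rfl
  · exact fun e => h.1 (e ▸ vars_mem_varSet I j s')
  · exact fun e => h.2 (e ▸ vars_mem_varSet I j s')

/-- **A non-degenerate row does not read a private tree edge outside `D e₀`.**  Hypotheses on the constraint `(C, G, T)` behind `q_{mv}` as in
`PstarCrossProductRow.untouched_of_product_row`. -/
theorem untouched_of_not_mem_D (hI : I.IsPure xorAndPred) (hS : SimpleOverlap I) (hB : BoundaryExpanding r I) (hD : CrossData I r B e_p e_q g₀)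
    {e₀ : Fin m} (he₀ : e₀ ∈ B.N) {mv : V2} {C : Finset (Fin n)} {G T : Finset (Fin m)} (hTJ : T ⊆ B.J₀ \ B.N) (hGJ : Disjoint G B.J₀)
    (hGfree : ∀ g ∈ G, ¬ (I.vars g 2 ∈ privs I B.N ∨ I.vars g 3 ∈ privs I B.N))
    (hlin : ∀ (π : Fin m) (s : Fin 4), π ∈ B.J₀ \ B.N → 2 ≤ s.val → qDir I B mv (Pi.single (I.vars π s) 1) = qDir I B mv 0 → I.vars π s ∉ C)
    (hpol : ∀ c d : Fin n, polarDir I B mv (Pi.single c 1) (Pi.single d 1) =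
      ((polar T (fun j => I.vars j 2) (fun j => I.vars j 3) + polar (freeMon I B.N G) (fun j => I.vars j 2) (fun j => I.vars j 3) :
        LinearMap.BilinForm (ZMod 2) (Fin n → ZMod 2)) (Pi.single c 1)) (Pi.single d 1))
    {κ : ZMod 2} {μ₁ μ₂ : (Fin n → ZMod 2) → ZMod 2} (h₁ : IsAffineFn μ₁) (h₂ : IsAffineFn μ₂)
    (hn₁ : ∃ z, μ₁ z ≠ μ₁ 0) (hn₂ : ∃ z, μ₂ z ≠ μ₂ 0) (hn : ∃ z, μ₁ z + μ₁ 0 ≠ μ₂ z + μ₂ 0)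
    (hrow : (∀ x, qDir I B mv x + κ = μ₁ x * μ₂ x) ∨ (∀ x, (sys I B).u e₀ x + (qDir I B mv x + κ) = μ₁ x * μ₂ x))
    (hZ : ∀ x, (sys I B).u e₀ x = 0 → μ₁ x * μ₂ x = 0)
    {π : Fin m} (hπ : PrivEdge I B π) (hπD : π ∉ B.D e₀) :
    (I.vars π 2 ∉ C ∧ I.vars π 3 ∉ C) ∧ ∀ g ∈ G, I.vars g 2 ≠ I.vars π 2 ∧ I.vars g 3 ≠ I.vars π 2 ∧ I.vars g 2 ≠ I.vars π 3 ∧ I.vars g 3 ≠ I.vars π 3 :=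
  untouched_of_product_row I hI hS hD he₀ hTJ hGJ hGfree hlin hpol h₁ h₂ hrow hπ fun _ hs =>
    factors_fixed_off_D I hI hS hB hD he₀ h₁ h₂ hn₁ hn₂ hn hZ (unread_of_not_mem_D I hD he₀ hπ hπD hs)

end

end Summit.PneNP.PneNP.Theorems.PstarCrossCaseU2Touch
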